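import Literature.MathematicalPhysics.QuantumFieldTheory.Balaban1983to89.Node00.OpsYDeltaA

/-!
# `Balaban1983to89.Node00.OpsYCoarseBondRep` — [B9] (3.12)–(3.15) p. 393, (3.26) p. 395 and [4] (2.3) p. 224, (2.45) p. 231 at NODE 00's
# letters: THE REPRESENTATIVE FINE BOND OF AN INDEX BOND (injective), the restriction ∕ extension-by-zero pair along it, and the bond letters
# `Q(U)`, `Q*(U)`, `a` of `Δ_a(U)` read ON THE FINE-BOND CARRIER `FBondY i → 𝔸` (item «60b» of this lineage; dag-n06-c's Route L, DESIGN POINT 1)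

T. Bałaban, *Propagators for lattice gauge theories in a background field*, Commun. Math. Phys. **99** (1985) 389–434
[`Balaban1985BackgroundPropagators`, "B9"]; [4] = T. Bałaban, *Propagators and renormalization transformations for lattice gauge
theories. II*, Commun. Math. Phys. **96** (1984) 223–250 [`Balaban1984PropagatorsII`].  statement-level skeleton of published definitions
with citation tags; proofs where landed; nothing here is a claim about the Yang–Mills mass gap.

THE POINT.  NODE 00's operator `Δ_a(U)` of (3.26) is the word `deltaAY i parS parB Gp U = hessY U + gradY U ∘ RY ∘ divY U + QsY ∘ aY ∘ QY`
(`Node00.OpsYDeltaA`), whose third term passes through the COARSE-BOND carrier `IBondY i → 𝔸` (the index bonds `𝔅` of [4] (2.45),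
`QY : (FBondY i → 𝔸) →ₗ (IBondY i → 𝔸)`, `aY`, `QsY`).  The Sect.-B frames of the referee cell r06 (`B9SectBGFrameV3.GFrame₃`: letters
`Qb Qsb ab : Module.End ℝ ((κ × S i) × ι → ℝ)`) and dag-n06-c's Route L read ALL bond letters on ONE carrier — the fine bonds (in the coordinates
of `Node00.OpsYBondCoords`).  This file supplies the missing brick: an INJECTIVE, LOCAL choice of a fine bond `repBondY i ι` inside every index
bond `ι`, the induced restriction `resBondY` and extension-by-zero `extBondY` with `resBondY ∘ₗ extBondY = id`, and the letters
`QbY := extBondY ∘ QY`, `QsbY := QsY ∘ resBondY`, `abY := extBondY ∘ aY ∘ resBondY` on the fine-bond carrier with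
`QsbY ∘ abY ∘ QbY = QsY ∘ aY ∘ QY` — so `Δ_a(U)` is a word in endomorphisms of `FBondY i → 𝔸` alone (`deltaAY_eq_fineBondWord`).

WHY THE ANCHOR (the one non-obvious point).  The naive representative «the fine bond at the embedded initial point `embIter j b₋` in the
direction of `b`» (the point NODE 00's transporter `OpsYDeltaA.qT` refers to — a transporter assignment needs no injectivity) is NOT injective on
`𝔅`: by [4] (2.3) p. 224 (`Λ_j = st(Ω_j) ∖ st(Ω_{j+1})`: at least one end-point in `Ω_j`, none inside `Ω_{j+1}`) a level-`(j+1)` bond ENTERING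
`Ω_{j+1}` from a point `y′ ∉ Ω_{j+1}` and the level-`j` bond at `emb y′` in the same direction are both index bonds and share that fine bond.
The cure is print's own reading of `st(Ω_j)`: ANCHOR the index bond at an end-point lying in `Ω_j^{(j)}` (the initial point if it does,
else the final point) and take the fine bond ADJACENT TO THE ANCHOR INSIDE the coarse bond.  Injectivity (`repBondY_injective`) then rests on
three elementary facts, all proved here over the ABSTRACT domain structure `B6SectADomainsV1.Domains` and the torus of `Setup`:
(i) embedded points of level `≥ 1` are CENTRED — every label is `≡ (L−1)/2 (mod L)` (`Site.val_emb`; `L` odd, `L ≥ 3`) — so no two of them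
differ by one lattice step (this kills every mixed initial∕final collision); (ii) `embIter j` is injective; (iii) a cross-level coincidence
`embIter j a = embIter j′ a′`, `j < j′`, `a′ ∈ Ω_{j′}^{(j′)}`, forces `a` to be deep at level `j` (`Domains.nested` + `Site.blockOf_emb`),
contradicting `a ∈ Λ_j`.

CONTENTS.  §1 torus ∕ domain lemmas (`Centred`, `centred_embIter`, `embIter_injective`, `embIter_succ_ne_shift`, `embDown`, `embIter_add`,
`deep_of_embIter_eq`); §2 the anchored representative `repOf` over the abstract domain structure, its faces and ★★ `repOf_core`∕`repOf_inj`; §3 ★ `repBondY` of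
the member with its faces and ★★ `repBondY_injective`; §4 (any `ℂ`-module `𝔸`) `resBondY`, `extBondY`, ★ `resBondY_comp_extBondY`; §5 the
letters `QbY`, `QsbY`, `abY`, their values at ∕ off the representatives, ★★ `QsbY_comp_abY_comp_QbY` and ★★★ `deltaAY_eq_fineBondWord`.
Definitions with bodies and theorems; no `def … : Prop`, no `instance`, no `notation`; standard axioms (the anchor test `b₋ ∈ Ω_j^{(j)}` is
`Finset`-decidable; classical choice only inside `extBondY`'s indicator).

HONEST SCOPE.  Bookkeeping on landed definitions: which fine bond represents an index bond is OUR convention (print sums over `𝔅` directly);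
any injective choice gives the same composite `Q*aQ`, this one is local (the representative lies in the blocks of the index bond's end-points)
so that blockwise majorants of `QbY`∕`QsbY` can later be read from those of `QY`∕`QsY` (not done here).  Nothing of [B9]'s estimates is
asserted; integer torus; not summit progress.  Unit `pub-ymgap-node00-def-Y` (gen 24), 2026-08-28.
-/

namespace Literature.MathematicalPhysics.QuantumFieldTheory.Balaban1983to89.Node00

open B6KLevelCensusIndexV1 (KIdx)
open B6GlobalChartV1 (PV domT)
open B15DeterminingSets (embIter)
open B6SectADomainsV1 (Domains)

/-! ## §1 Torus and domain lemmas: centred embedded points, injectivity of `embIter`, depth across levels -/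

section Torus

variable {P : Params}

/-- a site of the finest torus is CENTRED when every label is `≡ (L−1)/2 (mod L)` — the residue of every embedded coarser point
(`Setup.emb`: label `n ↦ nL + (L−1)/2`). [cite: Balaban1987RG1, (0.1) p.251 («lattice of centers»), dictionary] -/
def Centred (s : Site P 0) : Prop := ∀ ν, (s ν).val % P.L = (P.L - 1) / 2

/-- `L ≥ 3` (`L` odd and `> 1`). [folklore] -/
private theorem three_le_L (P : Params) : 3 ≤ P.L := by
  obtain ⟨⟨r, hr⟩, h1⟩ := P.hL
  omega

/-- `(L−1)/2 < L`. [folklore] -/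
private theorem half_pred_lt_L (P : Params) : (P.L - 1) / 2 < P.L := by
  have := P.hL.2
  omega

/-- `(L−1)/2 + 1 < L`. [folklore] -/
private theorem half_pred_succ_lt_L (P : Params) : (P.L - 1) / 2 + 1 < P.L := by
  have := three_le_L P
  omega

/-- `L` divides the number of sites per direction of the finest torus (`2L^{m+K}`, `m + K ≥ 1`). [cite: Balaban1987RG1, (0.1) p.251, bookkeeping] -/
theorem L_dvd_sitesPerDir_zero (h : 1 ≤ P.m + P.K) : P.L ∣ P.sitesPerDir 0 := by
  unfold Params.sitesPerDir
  rw [Nat.sub_zero]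
  exact dvd_mul_of_dvd_right (dvd_pow_self P.L (by omega)) 2

/-- an embedded level-1 point is centred. [cite: Balaban1987RG1, (0.1) p.251, bookkeeping] -/
theorem centred_emb (h : 1 ≤ P.m + P.K) (y : Site P 1) : Centred (emb y) := by
  intro ν
  rw [Site.val_emb h, Nat.mul_comm, Nat.mul_add_mod]
  exact Nat.mod_eq_of_lt (half_pred_lt_L P)

/-- ★ every embedded point of level `≥ 1` is centred. [cite: Balaban1987RG1, (0.1) p.251, bookkeeping] -/
theorem centred_embIter : ∀ (j : ℕ) (y : Site P (j + 1)), j + 1 ≤ P.m + P.K → Centred (embIter (j + 1) y)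
  | 0, y, h => centred_emb h y
  | j + 1, y, h => by
    show Centred (embIter (j + 1) (emb y))
    exact centred_embIter j (emb y) (by omega)

/-- a centred point shifted by one lattice step is not centred (`L ≥ 3`, `L ∣ 2L^{m+K}`). [cite: Balaban1987RG1, (0.1) p.251, bookkeeping] -/
theorem not_centred_shift (h : 1 ≤ P.m + P.K) {s : Site P 0} (hs : Centred s) (μ : Fin P.d) : ¬ Centred (s.shift μ) := by
  intro hc
  have h1 := hc μ
  have h0 := hs μ
  haveI : Fact (1 < P.sitesPerDir 0) := ⟨P.one_lt_sitesPerDir 0⟩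
  simp only [Site.shift, Function.update_self] at h1
  rw [ZMod.val_add, ZMod.val_one, Nat.mod_mod_of_dvd _ (L_dvd_sitesPerDir_zero h), Nat.add_mod, h0,
    Nat.mod_eq_of_lt (by have := three_le_L P; omega : 1 < P.L), Nat.mod_eq_of_lt (half_pred_succ_lt_L P)] at h1
  omega

/-- ★ NO TWO EMBEDDED POINTS OF LEVEL `≥ 1` DIFFER BY ONE LATTICE STEP. [cite: Balaban1987RG1, (0.1) p.251, bookkeeping] -/
theorem embIter_succ_ne_shift (j j' : ℕ) (y : Site P (j + 1)) (y' : Site P (j' + 1)) (h : j + 1 ≤ P.m + P.K) (h' : j' + 1 ≤ P.m + P.K)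
    (μ : Fin P.d) : embIter (j + 1) y ≠ (embIter (j' + 1) y').shift μ := fun he =>
  not_centred_shift (by omega) (centred_embIter j' y' h') μ (he ▸ centred_embIter j y h)

/-- `emb` is injective (standing range). [cite: Balaban1987RG1, (0.1) p.251, bookkeeping] -/
theorem emb_injective {j : ℕ} (h : j + 1 ≤ P.m + P.K) : Function.Injective (emb : Site P (j + 1) → Site P j) := by
  intro y y' he
  funext ν
  apply ZMod.val_injective
  have hν := congrArg (fun s : Site P j => (s ν).val) he
  simp only [Site.val_emb h] at hν
  exact Nat.eq_of_mul_eq_mul_right P.L_pos (by omega)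

/-- ★ `embIter j` is injective (standing range). [cite: Balaban1987RG1, (0.1) p.251, bookkeeping] -/
theorem embIter_injective : ∀ (j : ℕ), j ≤ P.m + P.K → Function.Injective (embIter (P := P) j)
  | 0, _ => fun _ _ h => h
  | j + 1, h => fun _ _ he => emb_injective h (embIter_injective j (by omega) he)

/-- the `n`-fold embedding `T^{(j+n)} → T^{(j)}` (so that `embIter (j + n) = embIter j ∘ embDown j n`). [cite: Balaban1987RG1, (0.1) p.251, dictionary] -/
def embDown (j : ℕ) : (n : ℕ) → Site P (j + n) → Site P j
  | 0 => fun y => y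
  | n + 1 => fun y => embDown j n (emb y)

/-- `embIter (j + n) = embIter j ∘ embDown j n`. [cite: Balaban1987RG1, (0.1) p.251, bookkeeping] -/
theorem embIter_add (j : ℕ) : ∀ (n : ℕ) (y : Site P (j + n)), embIter (j + n) y = embIter j (embDown j n y)
  | 0, _ => rfl
  | n + 1, y => by
    show embIter (j + n) (emb y) = embIter j (embDown j n (emb y))
    exact embIter_add j n (emb y)

/-- along the embeddings a point of `Ω_{j+n+1}^{(j+n+1)}` lands on a level-`j` point whose block lies in `Ω_{j+1}^{(j+1)}` (`Ω`'s are nested and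
made of blocks). [cite: Balaban1984PropagatorsII, (2.1)–(2.3) p.224] -/
theorem blockOf_embDown_succ_mem (D : Domains P) (j : ℕ) :
    ∀ (n : ℕ) (y : Site P (j + (n + 1))), j + (n + 1) ≤ P.m + P.K → y ∈ D.Om (j + (n + 1)) → blockOf (embDown j (n + 1) y) ∈ D.Om (j + 1)
  | 0, y, h, hy => by
    show blockOf (emb y) ∈ _
    rw [Site.blockOf_emb h]
    exact hy
  | n + 1, y, h, hy => by
    show blockOf (embDown j (n + 1) (emb y)) ∈ _
    refine blockOf_embDown_succ_mem D j n (emb y) (by omega) ?_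
    apply D.nested
    rw [Site.blockOf_emb (by omega : j + (n + 1) + 1 ≤ P.m + P.K)]
    exact hy

/-- ★ A CROSS-LEVEL COINCIDENCE FORCES DEPTH: if `embIter j a = embIter j′ a′` with `j < j′` and `a′ ∈ Ω_{j′}^{(j′)}`, then `a` is deep at
level `j` (its `(j+1)`-block belongs to `Ω_{j+1}^{(j+1)}`). [cite: Balaban1984PropagatorsII, (2.3) p.224, bookkeeping] -/
theorem deep_of_embIter_eq (D : Domains P) {j n : ℕ} (a : Site P j) (a' : Site P (j + (n + 1))) (h : j + (n + 1) ≤ P.m + P.K)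
    (ha' : a' ∈ D.Om (j + (n + 1))) (he : embIter j a = embIter (j + (n + 1)) a') : D.Deep j a := by
  rw [embIter_add j (n + 1) a'] at he
  have hae : a = embDown j (n + 1) a' := embIter_injective j (by omega) he
  rw [hae]
  exact blockOf_embDown_succ_mem D j n a' h ha'

/-- `(x − e_μ) + e_μ = x`. [folklore] -/
private theorem shift_unshift' {j : ℕ} (x : Site P j) (μ : Fin P.d) : (x.unshift μ).shift μ = x := by
  funext ν
  by_cases hν : ν = μ
  · subst hν; simp [Site.shift, Site.unshift]
  · simp [Site.shift, Site.unshift, Function.update_of_ne hν]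

/-- `(x + e_μ) − e_μ = x`. [folklore] -/
private theorem unshift_shift' {j : ℕ} (x : Site P j) (μ : Fin P.d) : (x.shift μ).unshift μ = x := by
  funext ν
  by_cases hν : ν = μ
  · subst hν; simp [Site.shift, Site.unshift]
  · simp [Site.shift, Site.unshift, Function.update_of_ne hν]

end Torus

/-! ## §2 The anchored representative fine bond of a bond of `𝔅` -/

section RepOf

variable {P : Params} (D : Domains P)

/-- THE ANCHORED REPRESENTATIVE over the abstract domain structure: for a level-`j` bond `b`, the fine bond of `b`'s direction starting at the
embedded initial point `embIter j b₋` if `b₋ ∈ Ω_j^{(j)}`, else ending at the embedded final point `embIter j b₊`.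
[cite: Balaban1985BackgroundPropagators, (3.12)–(3.14) p.393; Balaban1984PropagatorsII, (2.3) p.224, (2.45) p.231, dictionary] -/
def repOf (j : ℕ) (b : PBond P j) : PBond P 0 :=
  if b.src ∈ D.Om j then ⟨embIter j b.src, b.dir⟩ else ⟨(embIter j b.tgt).unshift b.dir, b.dir⟩

/-- the representative has the direction of the bond. [cite: Balaban1985BackgroundPropagators, (3.12) p.393, dictionary] -/
@[simp] theorem repOf_dir (j : ℕ) (b : PBond P j) : (repOf D j b).dir = b.dir := by
  unfold repOf; split_ifs <;> rfl

/-- source-anchored case. [cite: Balaban1985BackgroundPropagators, (3.12) p.393, dictionary] -/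
theorem repOf_of_mem {j : ℕ} {b : PBond P j} (h : b.src ∈ D.Om j) : repOf D j b = ⟨embIter j b.src, b.dir⟩ := by
  unfold repOf; rw [if_pos h]

/-- target-anchored case. [cite: Balaban1985BackgroundPropagators, (3.12) p.393, dictionary] -/
theorem repOf_of_not_mem {j : ℕ} {b : PBond P j} (h : b.src ∉ D.Om j) : repOf D j b = ⟨(embIter j b.tgt).unshift b.dir, b.dir⟩ := by
  unfold repOf; rw [if_neg h]

/-- target-anchored case, final point: the representative ENDS at the embedded final point. [cite: Balaban1985BackgroundPropagators, (3.12) p.393, dictionary] -/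
theorem repOf_tgt_of_not_mem {j : ℕ} {b : PBond P j} (h : b.src ∉ D.Om j) : (repOf D j b).tgt = embIter j b.tgt := by
  rw [repOf_of_not_mem D h]
  exact shift_unshift' _ _

/-- LEVEL 0: a fine bond of `Λ₀` represents itself (`Ω₀ = T`, `embIter 0 = id`). [cite: Balaban1984PropagatorsII, (2.3) p.224, bookkeeping] -/
@[simp] theorem repOf_zero (b : PBond P 0) : repOf D 0 b = b := by
  rw [repOf_of_mem D (by rw [D.Om_zero]; exact Finset.mem_univ _)]
  rfl

/-- two bonds with the same final point and direction are equal. [folklore] -/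
private theorem PBond.eq_of_tgt_eq_of_dir_eq {j : ℕ} {b b' : PBond P j} (ht : b.tgt = b'.tgt) (hd : b.dir = b'.dir) : b = b' := by
  have hs : b.src = b'.src := by
    have := congrArg (fun x : Site P j => x.unshift b.dir) ht
    simp only [PBond.tgt] at this
    rw [unshift_shift', hd, unshift_shift'] at this
    exact this
  cases b; cases b'
  simp only [PBond.mk.injEq]
  exact ⟨hs, hd⟩

/-- ★★ THE CORE OF INJECTIVITY (levels as naturals, `j ≤ j′`): two bonds of `𝔅` ([4] (2.3): one end-point in `Ω`, none deep) with the same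
anchored representative have the same level and are equal.  Mixed initial∕final collisions are excluded by centredness
(`embIter_succ_ne_shift`), cross-level ones by depth (`deep_of_embIter_eq`). [cite: Balaban1984PropagatorsII, (2.3) p.224, (2.45) p.231, bookkeeping] -/
theorem repOf_core {j j' : ℕ} (hjj : j ≤ j') (hj' : j' ≤ P.m + P.K) {b : PBond P j} {b' : PBond P j'} (hb : D.LamBond j b)
    (hb' : D.LamBond j' b') (he : repOf D j b = repOf D j' b') : j = j' ∧ HEq b b' := by
  have hdir : b.dir = b'.dir := by simpa using congrArg PBond.dir he
  rcases hjj.eq_or_lt with hjeq | hlt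
  · -- SAME LEVEL
    subst hjeq
    refine ⟨rfl, heq_of_eq ?_⟩
    by_cases h : b.src ∈ D.Om j <;> by_cases h' : b'.src ∈ D.Om j
    · rw [repOf_of_mem D h, repOf_of_mem D h'] at he
      have hs : embIter j b.src = embIter j b'.src := congrArg PBond.src he
      have := embIter_injective j hj' hs
      cases b; cases b'; simp only [PBond.mk.injEq]; exact ⟨this, hdir⟩
    · exfalso
      rw [repOf_of_mem D h, repOf_of_not_mem D h'] at he
      have hs : embIter j b.src = (embIter j b'.tgt).unshift b'.dir := congrArg PBond.src he
      have hs2 : (embIter j b.src).shift b'.dir = embIter j b'.tgt := by rw [hs]; exact shift_unshift' _ _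
      rcases j with _ | j0
      · exact h' (by rw [D.Om_zero]; exact Finset.mem_univ _)
      · exact embIter_succ_ne_shift j0 j0 b'.tgt b.src hj' hj' b'.dir hs2.symm
    · exfalso
      rw [repOf_of_not_mem D h, repOf_of_mem D h'] at he
      have hs : (embIter j b.tgt).unshift b.dir = embIter j b'.src := congrArg PBond.src he
      have hs2 : embIter j b.tgt = (embIter j b'.src).shift b.dir := by rw [← hs]; exact (shift_unshift' _ _).symm
      rcases j with _ | j0
      · exact h (by rw [D.Om_zero]; exact Finset.mem_univ _)
      · exact embIter_succ_ne_shift j0 j0 b.tgt b'.src hj' hj' b.dir hs2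
    · rw [repOf_of_not_mem D h, repOf_of_not_mem D h'] at he
      have hs : (embIter j b.tgt).unshift b.dir = (embIter j b'.tgt).unshift b'.dir := congrArg PBond.src he
      have ht : embIter j b.tgt = embIter j b'.tgt := by
        have := congrArg (fun x : Site P 0 => x.shift b.dir) hs
        rw [shift_unshift', hdir, shift_unshift'] at this
        exact this
      exact PBond.eq_of_tgt_eq_of_dir_eq (embIter_injective j hj' ht) hdir
  · -- `j < j′ = j + n + 1`: every case contradicts `b ∈ Λ_j`
    exfalso
    obtain ⟨n, rfl⟩ := Nat.exists_eq_add_of_lt hlt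
    -- the anchor of `b′` lies in `Ω_{j′}`
    by_cases h : b.src ∈ D.Om j <;> by_cases h' : b'.src ∈ D.Om (j + n + 1)
    · rw [repOf_of_mem D h, repOf_of_mem D h'] at he
      have hs : embIter j b.src = embIter (j + n + 1) b'.src := congrArg PBond.src he
      exact hb.2.1 (deep_of_embIter_eq D b.src b'.src hj' h' hs)
    · rw [repOf_of_mem D h, repOf_of_not_mem D h'] at he
      have ht' : b'.tgt ∈ D.Om (j + n + 1) := hb'.1.resolve_left h'
      have hs : embIter j b.src = (embIter (j + n + 1) b'.tgt).unshift b'.dir := congrArg PBond.src he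
      have hs2 : (embIter j b.src).shift b'.dir = embIter (j + n + 1) b'.tgt := by rw [hs]; exact shift_unshift' _ _
      rcases j with _ | j0
      · -- level 0: `b₊ = embIter j′ b′₊` is deep
        have hb2 : embIter 0 b.tgt = embIter (0 + n + 1) b'.tgt := by
          rw [← hs2, ← hdir]; rfl
        exact hb.2.2 (deep_of_embIter_eq D b.tgt b'.tgt hj' ht' hb2)
      · exact embIter_succ_ne_shift (j0 + 1 + n) j0 b'.tgt b.src hj' (by omega) b'.dir hs2.symm
    · rw [repOf_of_not_mem D h, repOf_of_mem D h'] at he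
      have hs : (embIter j b.tgt).unshift b.dir = embIter (j + n + 1) b'.src := congrArg PBond.src he
      have hs2 : embIter j b.tgt = (embIter (j + n + 1) b'.src).shift b.dir := by rw [← hs]; exact (shift_unshift' _ _).symm
      rcases j with _ | j0
      · -- level 0: `b₋ = embIter j′ b′₋` is deep
        have hb2 : embIter 0 b.src = embIter (0 + n + 1) b'.src := by
          have := congrArg (fun x : Site P 0 => x.unshift b.dir) hs2
          rw [unshift_shift'] at this
          rw [← this]; exact (unshift_shift' _ _).symm
        exact hb.2.1 (deep_of_embIter_eq D b.src b'.src hj' h' hb2)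
      · exact embIter_succ_ne_shift j0 (j0 + 1 + n) b.tgt b'.src (by omega) hj' b.dir hs2
    · rw [repOf_of_not_mem D h, repOf_of_not_mem D h'] at he
      have ht' : b'.tgt ∈ D.Om (j + n + 1) := hb'.1.resolve_left h'
      have hs : (embIter j b.tgt).unshift b.dir = (embIter (j + n + 1) b'.tgt).unshift b'.dir := congrArg PBond.src he
      have ht : embIter j b.tgt = embIter (j + n + 1) b'.tgt := by
        have := congrArg (fun x : Site P 0 => x.shift b.dir) hs
        rw [shift_unshift', hdir, shift_unshift'] at this
        exact this
      exact hb.2.2 (deep_of_embIter_eq D b.tgt b'.tgt hj' ht' ht)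

/-- ★★ INJECTIVITY OF THE ANCHORED REPRESENTATIVE on the bonds of `𝔅` (symmetric form). [cite: Balaban1984PropagatorsII, (2.3) p.224, (2.45) p.231, bookkeeping] -/
theorem repOf_inj {j j' : ℕ} (hj : j ≤ P.m + P.K) (hj' : j' ≤ P.m + P.K) {b : PBond P j} {b' : PBond P j'} (hb : D.LamBond j b)
    (hb' : D.LamBond j' b') (he : repOf D j b = repOf D j' b') : j = j' ∧ HEq b b' := by
  rcases le_total j j' with hle | hle
  · exact repOf_core D hle hj' hb hb' he
  · obtain ⟨h1, h2⟩ := repOf_core D hle hj hb' hb he.symm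
    exact ⟨h1.symm, h2.symm⟩

end RepOf

/-! ## §3 The representative fine bond of an index bond of a member and the restriction ∕ extension pair -/

section Rep

variable {d ℓ : ℕ} {hd : 1 ≤ d + 1} {hL : Odd (ℓ + 1) ∧ 1 < ℓ + 1} {b₀ b₁ : ℝ}
variable (i : KIdx d ℓ hd hL b₀ b₁)

/-- ★ THE REPRESENTATIVE FINE BOND `repBondY i ι` of the index bond `ι = (j, b) ∈ 𝔅` of the member: the anchored representative of `b` for the
member's domains `domT`. [cite: Balaban1985BackgroundPropagators, (3.12)–(3.14) p.393; Balaban1984PropagatorsII, (2.45) p.231, dictionary] -/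
def repBondY (ι : IBondY i) : FBondY i := repOf (domT i.hN i.D i.hk) (ι.1.1 : ℕ) ι.1.2

/-- the representative has the direction of the index bond. [cite: Balaban1985BackgroundPropagators, (3.12) p.393, dictionary] -/
@[simp] theorem repBondY_dir (ι : IBondY i) : (repBondY i ι).dir = ι.1.2.dir := repOf_dir _ _ _

/-- source-anchored index bonds: the representative STARTS at the embedded initial point (the point `OpsYDeltaA.qT` transports to).
[cite: Balaban1985BackgroundPropagators, (3.12) p.393, dictionary] -/
theorem repBondY_of_mem {ι : IBondY i} (h : ι.1.2.src ∈ (domT i.hN i.D i.hk).Om (ι.1.1 : ℕ)) :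
    repBondY i ι = ⟨embIter (ι.1.1 : ℕ) ι.1.2.src, ι.1.2.dir⟩ := repOf_of_mem _ h

/-- target-anchored index bonds: the representative ENDS at the embedded final point. [cite: Balaban1985BackgroundPropagators, (3.12) p.393, dictionary] -/
theorem repBondY_of_not_mem {ι : IBondY i} (h : ι.1.2.src ∉ (domT i.hN i.D i.hk).Om (ι.1.1 : ℕ)) :
    repBondY i ι = ⟨(embIter (ι.1.1 : ℕ) ι.1.2.tgt).unshift ι.1.2.dir, ι.1.2.dir⟩ := repOf_of_not_mem _ h

/-- target-anchored index bonds, final point. [cite: Balaban1985BackgroundPropagators, (3.12) p.393, dictionary] -/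
theorem repBondY_tgt_of_not_mem {ι : IBondY i} (h : ι.1.2.src ∉ (domT i.hN i.D i.hk).Om (ι.1.1 : ℕ)) :
    (repBondY i ι).tgt = embIter (ι.1.1 : ℕ) ι.1.2.tgt := repOf_tgt_of_not_mem _ h

/-- LEVEL 0: an index bond of `Λ₀` is represented by itself. [cite: Balaban1984PropagatorsII, (2.3) p.224, bookkeeping] -/
theorem repBondY_level_zero (b : FBondY i) (hb : (domT i.hN i.D i.hk).LamBond ((0 : Fin ((domT i.hN i.D i.hk).k + 1)) : ℕ) b) :
    repBondY i ⟨⟨0, b⟩, hb⟩ = b := repOf_zero _ b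

/-- index bonds have level `≤ k ≤ m + K` (standing range of the member). [cite: Balaban1984PropagatorsII, (2.3) p.224, bookkeeping] -/
theorem ibond_level_le (ι : IBondY i) : (ι.1.1 : ℕ) ≤ (PV d ℓ i.m i.K hd hL).m + (PV d ℓ i.m i.K hd hL).K := by
  have h1 := ι.1.1.isLt
  have h2 := i.hk
  show (ι.1.1 : ℕ) ≤ i.m + i.K
  have h3 : (domT i.hN i.D i.hk).k = i.k := rfl
  omega

/-- ★★ THE REPRESENTATIVE FINE BOND IS INJECTIVE ON THE INDEX BONDS `𝔅` OF THE MEMBER. [cite: Balaban1984PropagatorsII, (2.3) p.224, (2.45) p.231, bookkeeping] -/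
theorem repBondY_injective : Function.Injective (repBondY i) := by
  rintro ⟨⟨j, b⟩, hb⟩ ⟨⟨j', b'⟩, hb'⟩ he
  have hl := ibond_level_le i ⟨⟨j, b⟩, hb⟩
  have hl' := ibond_level_le i ⟨⟨j', b'⟩, hb'⟩
  obtain ⟨hjj, hbb⟩ := repOf_inj (domT i.hN i.D i.hk) hl hl' hb hb' he
  have hj : j = j' := Fin.ext hjj
  subst hj
  have hb2 : b = b' := eq_of_heq hbb
  subst hb2
  rfl

/-- the representatives form a finite set of fine bonds of the same cardinality as `𝔅`. [cite: Balaban1984PropagatorsII, (2.45) p.231, bookkeeping] -/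
theorem card_ibondY_le_card_fbondY : Fintype.card (IBondY i) ≤ Fintype.card (FBondY i) :=
  Fintype.card_le_of_injective _ (repBondY_injective i)

end Rep

/-! ## §4 Restriction and extension by zero along the representative (any `ℂ`-module of values) -/

section Linear

variable {d ℓ : ℕ} {hd : 1 ≤ d + 1} {hL : Odd (ℓ + 1) ∧ 1 < ℓ + 1} {b₀ b₁ : ℝ}
variable (i : KIdx d ℓ hd hL b₀ b₁)
variable {𝔸 : Type*} [AddCommMonoid 𝔸] [Module ℂ 𝔸]

/-- RESTRICTION to the representatives: a fine-bond function read on `𝔅`, `(res F)(ι) = F(repBondY ι)`. [cite: Balaban1985BackgroundPropagators, (3.12) p.393, dictionary] -/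
def resBondY : (FBondY i → 𝔸) →ₗ[ℂ] (IBondY i → 𝔸) := LinearMap.funLeft ℂ 𝔸 (repBondY i)

/-- `res` pointwise. [cite: Balaban1985BackgroundPropagators, (3.12) p.393, dictionary] -/
@[simp] theorem resBondY_apply (F : FBondY i → 𝔸) (ι : IBondY i) : resBondY (𝔸 := 𝔸) i F ι = F (repBondY i ι) := rfl

open Classical in
/-- EXTENSION BY ZERO from the representatives: `(ext g)(b) = g(ι)` if `b = repBondY ι`, `0` if `b` represents no index bond.
[cite: Balaban1985BackgroundPropagators, (3.13) p.393, dictionary] -/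
noncomputable def extBondY : (IBondY i → 𝔸) →ₗ[ℂ] (FBondY i → 𝔸) where
  toFun g b := ∑ ι : IBondY i, if repBondY i ι = b then g ι else 0
  map_add' g g' := by
    funext b
    simp only [Pi.add_apply, ← Finset.sum_add_distrib]
    refine Finset.sum_congr rfl fun ι _ => ?_
    split_ifs <;> simp
  map_smul' c g := by
    funext b
    simp only [Pi.smul_apply, RingHom.id_apply, Finset.smul_sum, smul_ite, smul_zero]

open Classical in
/-- `ext` pointwise. [cite: Balaban1985BackgroundPropagators, (3.13) p.393, dictionary] -/
theorem extBondY_apply (g : IBondY i → 𝔸) (b : FBondY i) :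
    extBondY (𝔸 := 𝔸) i g b = ∑ ι : IBondY i, if repBondY i ι = b then g ι else 0 := by
  simp only [extBondY, LinearMap.coe_mk, AddHom.coe_mk]

/-- ★ `ext` AT A REPRESENTATIVE returns the value (injectivity). [cite: Balaban1985BackgroundPropagators, (3.13) p.393, bookkeeping] -/
@[simp] theorem extBondY_apply_repBondY (g : IBondY i → 𝔸) (κ : IBondY i) : extBondY (𝔸 := 𝔸) i g (repBondY i κ) = g κ := by
  classical
  rw [extBondY_apply, Finset.sum_eq_single κ]
  · rw [if_pos rfl]
  · intro ι _ hne
    rw [if_neg (fun h => hne (repBondY_injective i h))]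
  · intro h; exact absurd (Finset.mem_univ κ) h

/-- `ext` VANISHES off the representatives. [cite: Balaban1985BackgroundPropagators, (3.13) p.393, bookkeeping] -/
theorem extBondY_apply_of_not_mem_range (g : IBondY i → 𝔸) {b : FBondY i} (hb : b ∉ Set.range (repBondY i)) :
    extBondY (𝔸 := 𝔸) i g b = 0 := by
  classical
  rw [extBondY_apply]
  refine Finset.sum_eq_zero fun ι _ => ?_
  rw [if_neg (fun h => hb ⟨ι, h⟩)]

/-- ★ `res ∘ ext = id` on `𝔅`-functions. [cite: Balaban1985BackgroundPropagators, (3.12)–(3.13) p.393, bookkeeping] -/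
theorem resBondY_comp_extBondY : resBondY (𝔸 := 𝔸) i ∘ₗ extBondY i = LinearMap.id := by
  ext g κ
  simp

/-- `res (ext g) = g`. [cite: Balaban1985BackgroundPropagators, (3.12)–(3.13) p.393, bookkeeping] -/
@[simp] theorem resBondY_extBondY (g : IBondY i → 𝔸) : resBondY (𝔸 := 𝔸) i (extBondY i g) = g := by
  funext κ; simp

/-- `ext` is injective. [cite: Balaban1985BackgroundPropagators, (3.13) p.393, bookkeeping] -/
theorem extBondY_injective : Function.Injective (extBondY (𝔸 := 𝔸) i) := fun g g' h => by
  have := congrArg (resBondY (𝔸 := 𝔸) i) h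
  simpa using this

/-- `res` is surjective. [cite: Balaban1985BackgroundPropagators, (3.12) p.393, bookkeeping] -/
theorem resBondY_surjective : Function.Surjective (resBondY (𝔸 := 𝔸) i) := fun g => ⟨extBondY i g, resBondY_extBondY i g⟩

/-- `ext ∘ res` is idempotent (the projection onto functions supported on the representatives). [cite: Balaban1985BackgroundPropagators, (3.13) p.393, bookkeeping] -/
theorem extBondY_comp_resBondY_idem :
    (extBondY (𝔸 := 𝔸) i ∘ₗ resBondY i) ∘ₗ (extBondY i ∘ₗ resBondY i) = extBondY i ∘ₗ resBondY i := by
  rw [LinearMap.comp_assoc, ← LinearMap.comp_assoc (resBondY i) (extBondY i) (resBondY i), resBondY_comp_extBondY, LinearMap.id_comp]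

end Linear

/-! ## §5 The bond letters `Q(U)`, `Q*(U)`, `a` and `Δ_a(U)` on the fine-bond carrier -/

section Letters

variable {d ℓ : ℕ} {hd : 1 ≤ d + 1} {hL : Odd (ℓ + 1) ∧ 1 < ℓ + 1} {b₀ b₁ : ℝ}
variable (i : KIdx d ℓ hd hL b₀ b₁)
variable {𝔸 : Type} [NormedRing 𝔸] [NormedAlgebra ℂ 𝔸] [CompleteSpace 𝔸]

/-- ★ `Q(U)` READ ON FINE BONDS: average, then place the value of each index bond at its representative (`ext ∘ Q(U)`).
[cite: Balaban1985BackgroundPropagators, (3.12)–(3.14) p.393, dictionary] -/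
noncomputable def QbY (parB : BondParY 𝔸 i) (U : CfgY 𝔸 i) : Module.End ℂ (FBondY i → 𝔸) := extBondY i ∘ₗ QY i parB U

/-- ★ `Q*(U)` READ ON FINE BONDS: read the `𝔅`-function off the representatives, then apply `Q*(U)` (`Q*(U) ∘ res`).
[cite: Balaban1985BackgroundPropagators, (3.13) p.393, dictionary] -/
noncomputable def QsbY (parB : BondParY 𝔸 i) (U : CfgY 𝔸 i) : Module.End ℂ (FBondY i → 𝔸) := QsY i parB U ∘ₗ resBondY i

/-- ★ the weight `a` READ ON FINE BONDS (`ext ∘ a ∘ res`). [cite: Balaban1985BackgroundPropagators, (3.26) p.395, dictionary] -/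
noncomputable def abY : Module.End ℂ (FBondY i → 𝔸) := extBondY i ∘ₗ aY (𝔸 := 𝔸) i ∘ₗ resBondY i

/-- `QbY` applied. [cite: Balaban1985BackgroundPropagators, (3.12) p.393, dictionary] -/
theorem QbY_apply (parB : BondParY 𝔸 i) (U : CfgY 𝔸 i) (F : FBondY i → 𝔸) : QbY i parB U F = extBondY i (QY i parB U F) := rfl

/-- `QsbY` applied. [cite: Balaban1985BackgroundPropagators, (3.13) p.393, dictionary] -/
theorem QsbY_apply (parB : BondParY 𝔸 i) (U : CfgY 𝔸 i) (F : FBondY i → 𝔸) : QsbY i parB U F = QsY i parB U (resBondY i F) := rfl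

omit [CompleteSpace 𝔸] in
/-- `abY` applied. [cite: Balaban1985BackgroundPropagators, (3.26) p.395, dictionary] -/
theorem abY_apply (F : FBondY i → 𝔸) : abY (𝔸 := 𝔸) i F = extBondY i (aY i (resBondY i F)) := rfl

/-- `QbY` AT A REPRESENTATIVE is the block average of the index bond. [cite: Balaban1985BackgroundPropagators, (3.12) p.393, bookkeeping] -/
@[simp] theorem QbY_apply_repBondY (parB : BondParY 𝔸 i) (U : CfgY 𝔸 i) (F : FBondY i → 𝔸) (κ : IBondY i) :
    QbY i parB U F (repBondY i κ) = QY i parB U F κ := by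
  rw [QbY_apply, extBondY_apply_repBondY]

/-- `QbY` VANISHES off the representatives. [cite: Balaban1985BackgroundPropagators, (3.12) p.393, bookkeeping] -/
theorem QbY_apply_of_not_mem_range (parB : BondParY 𝔸 i) (U : CfgY 𝔸 i) (F : FBondY i → 𝔸) {b : FBondY i}
    (hb : b ∉ Set.range (repBondY i)) : QbY i parB U F b = 0 := by
  rw [QbY_apply, extBondY_apply_of_not_mem_range i _ hb]

omit [CompleteSpace 𝔸] in
/-- `abY` AT A REPRESENTATIVE is the weight `a` of the restricted function at the index bond. [cite: Balaban1985BackgroundPropagators, (3.26) p.395, bookkeeping] -/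
@[simp] theorem abY_apply_repBondY (F : FBondY i → 𝔸) (κ : IBondY i) : abY (𝔸 := 𝔸) i F (repBondY i κ) = aY i (resBondY i F) κ := by
  rw [abY_apply, extBondY_apply_repBondY]

omit [CompleteSpace 𝔸] in
/-- `abY` VANISHES off the representatives. [cite: Balaban1985BackgroundPropagators, (3.26) p.395, bookkeeping] -/
theorem abY_apply_of_not_mem_range (F : FBondY i → 𝔸) {b : FBondY i} (hb : b ∉ Set.range (repBondY i)) : abY (𝔸 := 𝔸) i F b = 0 := by
  rw [abY_apply, extBondY_apply_of_not_mem_range i _ hb]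

/-- `res ∘ QbY = Q(U)`: the fine-bond reading of `Q(U)` restricts back to `Q(U)`. [cite: Balaban1985BackgroundPropagators, (3.12) p.393, bookkeeping] -/
theorem resBondY_comp_QbY (parB : BondParY 𝔸 i) (U : CfgY 𝔸 i) : resBondY i ∘ₗ QbY i parB U = QY i parB U := by
  rw [QbY, ← LinearMap.comp_assoc, resBondY_comp_extBondY, LinearMap.id_comp]

/-- `QsbY ∘ ext = Q*(U)`. [cite: Balaban1985BackgroundPropagators, (3.13) p.393, bookkeeping] -/
theorem QsbY_comp_extBondY (parB : BondParY 𝔸 i) (U : CfgY 𝔸 i) : QsbY i parB U ∘ₗ extBondY i = QsY i parB U := by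
  rw [QsbY, LinearMap.comp_assoc, resBondY_comp_extBondY, LinearMap.comp_id]

/-- ★★ THE COMPOSITE IS PRINT'S: `Q*(U) a Q(U)` read on fine bonds equals NODE 00's `QsY ∘ aY ∘ QY` (the third term of (3.26)).
[cite: Balaban1985BackgroundPropagators, (3.26) p.395, bookkeeping] -/
theorem QsbY_comp_abY_comp_QbY (parB : BondParY 𝔸 i) (U : CfgY 𝔸 i) :
    QsbY i parB U ∘ₗ abY i ∘ₗ QbY i parB U = QsY i parB U ∘ₗ aY i ∘ₗ QY i parB U := by
  simp only [QsbY, abY, QbY, LinearMap.comp_assoc]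
  rw [← LinearMap.comp_assoc (QY i parB U) (extBondY i) (resBondY i), resBondY_comp_extBondY, LinearMap.id_comp,
    ← LinearMap.comp_assoc (aY i ∘ₗ QY i parB U) (extBondY i) (resBondY i), resBondY_comp_extBondY, LinearMap.id_comp]

/-- ★★★ `Δ_a(U)` (3.26) AS A WORD IN ENDOMORPHISMS OF THE FINE-BOND CARRIER ALONE:
`Δ_a(U) = Δ(U) + D_U R(U) D*_U + Q*(U) a Q(U)` with the last three letters `QsbY`, `abY`, `QbY`. [cite: Balaban1985BackgroundPropagators, (3.26) p.395] -/
theorem deltaAY_eq_fineBondWord (parS : SiteParY 𝔸 i) (parB : BondParY 𝔸 i) (Gp : SiteOpY 𝔸 i)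
    (U : CfgY 𝔸 i) :
    deltaAY i parS parB Gp U = hessY i U + gradY i U ∘ₗ RY i parS Gp U ∘ₗ divY i U + QsbY i parB U ∘ₗ abY i ∘ₗ QbY i parB U := by
  rw [QsbY_comp_abY_comp_QbY]; rfl

end Letters

end Literature.MathematicalPhysics.QuantumFieldTheory.Balaban1983to89.Node00
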